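import Literature.MathematicalPhysics.QuantumFieldTheory.Balaban1983to89.B9SectBCodedCarrier
import Literature.MathematicalPhysics.QuantumFieldTheory.Balaban1983to89.B9Thm314

/-!
# `Balaban1983to89.B9SectBCodedCarrierPullbacks` — the REMAINING carriers of the [B9] leaf read along a coding, and the TRANSFER
# of the base-only printed statements of Sect. 3 from a backgrounds record to its coded carrier

T. Bałaban, *Propagators for lattice gauge theories in a background field*, Commun. Math. Phys. **99** (1985) 389–434
[`Balaban1985BackgroundPropagators`, "B9"], Sect. 3: Theorem 3.1 (3.42)–(3.47) pp. 397–398, (3.49) p. 399, Corollary 3.6 p. 407,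
Theorem 3.7 (3.87) p. 409, Corollary 3.8 (3.94) p. 410, Theorem 3.9 (3.99) p. 412, Theorem 3.10 (3.107) p. 415, Theorem 3.11 p. 416,
Theorem 3.12 (3.130)–(3.133) pp. 421–422, (3.132) p. 422, Theorem 3.13 (3.154) p. 426, Theorem 3.14 pp. 426–427, Theorem 3.15
(3.185)–(3.187) p. 432; the regularity class (3.35)–(3.36) p. 396.

statement-level bookkeeping over published theorems with citation tags; nothing here is a claim about the Yang–Mills mass gap

THE PRINTED QUANTIFIER RANGE (verbatim, (3.35) p. 396): *"U is a gauge field configuration on T_η with values in G … for a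
configuration U there exists a gauge transformation u on □ such that U^u = e^{iηA} …"* — every statement of Sect. 3 outside
Sect. B (Theorems 3.1, 3.7, 3.9–3.15, Corollaries 3.6, 3.8, (3.49), (3.132)) is asked AT a configuration `U` of the class (3.35)
(and (3.36) where printed), never at the Sect.-B pairs `(U, U′ = e^{iηA′})`.

WHY THIS FILE (pub-ymgap N06 [B9], FLAG №8, road (α) of record — director-ym №282 (B); piece (α1), seat dag-n06-d).  The tree's
Sect.-B step of record is assembled over the CODED carrier of `B9SectBCodedCarrier` (`Coding.bg`: configurations `base U`,
`mult a`, `prod U a`; the classes (3.35)∕(3.36) hold at `base U` only), and the ₁₁ leaf `B9LeafX` is to be re-concluded over a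
carriers record whose backgrounds are these codings (def-Y's `Node00/CarriersYU`, piece (α2)).  That record needs EVERY operator
field of the [B9] leaf read along the decoding `Coding.dec` — not only the kernel families and site kernels of
`B9SectBCodedCarrier` (`pullK`, `pullS`) but also the fine-lattice (3.49) kernel, the Sect.-D `H`-kernels, the random-walk
expansions of Theorems 3.7∕3.9∕3.10, the configuration predicates of Theorem 3.11 ∕ (3.185), and the predicates ON kernel
families ∕ `H`-kernels of Theorems 3.12∕3.13 — and it needs the fact that each base-only printed statement, once supplied at
the record, HOLDS at the coding: a (3.35)-regular coded configuration IS `base U` for a (3.35)-regular `U`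
(`Coding.exists_of_bg_Reg335`), where every pulled-back object reads the record's at `U`.  §1 supplies the pullbacks, §2 the
transfers; both are class-agnostic (any `Coding`, any constant `c35`).

WHAT IS IN THE FILE (0 sorry; standard axioms; the `def`s are the nine pullbacks, no operator is constructed).
§1 `pullF` ((3.49) fine kernel), `pullH` (`HKernel`), `pullRW` (`RWExpansion`), `pullRWK` (`RWKernelExpansion`), `pullC`
(configuration predicates), `pullPK` ∕ `pullPK₀` (predicates on kernel families: «every record family pulling back to `K′` has
the property at `dec c`» — at `K′ = pullK K` this IS the record's predicate, `pullPK_pullK_iff`, by `pullK_injective`), `pullPH`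
(the same on `H`-kernels, `pullH_injective`, `pullPH_pullH_iff`), and the `Iff.rfl` transports `ineq342_346_347_noLap_pull_iff`,
`ineq3133_pull_iff`, `ineq3132_pull_iff`, `ineq349_pull_iff`.  §2 ★ the fourteen transfers RECORD ⇒ CODING:
`thm31Printed_coded`, `cor36Printed_coded`, `thm37Printed_coded`, `cor38Printed_coded`, `thm39Printed_coded`,
`thm310Printed_coded`, `thm311Printed_coded`, `thm312Printed_coded`, `thm313Printed_coded`, `thm314Printed_coded`,
`thm314LocalPrinted_coded`, `thm315FullPrinted_coded`, `stmt349Printed_coded`, `stmt3132Printed_coded` (each: destructure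
the printed constants, `obtain ⟨U, rfl, hU⟩ := (𝔠 i).exists_of_bg_Reg335 hv`, apply the record's statement at `U`; for 3.12∕3.13
the family ∕ `H`-predicates go through the `_iff` lemmas of §1).

HONEST SCOPE.  Quantifier bookkeeping along a decoding; nothing of [B9] is asserted or proved; no operator is constructed; the
Sect.-B direction (coding ⇒ record) and the coded step itself are `B9SectBCodedCarrier` ∕ `B9SectBCodedReadingsU(R)` ∕
`B9SectBStepUOfMembers`, not this file.  COUNT-NEUTRAL; N06 NOT discharged; FLAG №8 not closed by this file; one finite lattice
programme — nothing continuum ∕ OS ∕ mass-gap ∕ Clay.  Cell `pub-ymgap` (HUMAN RULING D-0062), Track A node N06 [B9], 2026-08-29.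

RELATED IN THE TREE, NOT DUPLICATED: `B9SectBCodedCarrier` (`Coding`, `pullK`, `pullS`, `pullAn`, `pullK_injective`,
`exists_of_bg_Reg335`, `thm32Printed_coded`, `thm33Printed_coded`, `sectBStepPrinted_of_coded` — USED BY NAME; its `pullK`∕`pullS`
are not re-declared), `B9` ∕ `B9Thm314` (the printed statement predicates — USED BY NAME), `Node00/CarriersYU` (def-Y, imports this file).
-/

namespace Literature.MathematicalPhysics.QuantumFieldTheory.Balaban1983to89.B9SectBCodedCarrierPullbacks

open B9 (Backgrounds Geometry KernelFamily SiteKernel FineKernel HKernel RWExpansion RWKernelExpansion Ineq342_346_347 Ineq342_346_347_noLap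
  Ineq343_345 Ineq349 Ineq3132 Ineq3133 Thm31Printed Thm311Printed Thm312Printed Thm313Printed Thm314Printed Thm315FullPrinted Thm37Printed Cor38Printed
  Thm39Printed Thm310Printed Stmt349Printed Stmt3132Printed Cor36Printed)
open B9SectBCodedCarrier (CCfg Coding pullK pullS pullK_injective)
open B9Thm314 (Thm314LocalPrinted IneqSupF IneqL2F IneqHolderF)

/-! ## §1 The remaining carriers of the [B9] leaf, read along the decoding -/

section Pull

variable {g : Geometry} {B : Backgrounds} (𝔠 : Coding B)

/-- the record's fine-lattice (3.49) kernel READ ALONG THE DECODING. [cite: Balaban1985BackgroundPropagators, (3.49) p.399, bookkeeping] -/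
def pullF (P : FineKernel g B) : FineKernel g 𝔠.bg where
  ker n c := P.ker n (𝔠.dec c)

/-- the record's Sect.-D `H`-kernel READ ALONG THE DECODING. [cite: Balaban1985BackgroundPropagators, (3.133) p.422, bookkeeping] -/
def pullH (H : HKernel g B) : HKernel g 𝔠.bg where
  e n c := H.e n (𝔠.dec c)
  h c := H.h (𝔠.dec c)

/-- the record's random-walk expansion (Theorem 3.7 ∕ 3.10) READ ALONG THE DECODING: same walks, terms ∕ localisation ∕ convergence at a coded configuration
:= those at the configuration it decodes to. [cite: Balaban1985BackgroundPropagators, Thm 3.7 (3.87) p.409, Thm 3.10 (3.107) p.415, bookkeeping] -/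
def pullRW (E : RWExpansion g B) : RWExpansion g 𝔠.bg where
  Walk := E.Walk
  wlen := E.wlen
  first := E.first
  last := E.last
  wdist := E.wdist
  term c := E.term (𝔠.dec c)
  LocDep c := E.LocDep (𝔠.dec c)
  Converges c := E.Converges (𝔠.dec c)

/-- the record's random-walk KERNEL expansion (Theorem 3.9) READ ALONG THE DECODING. [cite: Balaban1985BackgroundPropagators, Thm 3.9 (3.99) p.412, bookkeeping] -/
def pullRWK (E : RWKernelExpansion g B) : RWKernelExpansion g 𝔠.bg where
  Walk := E.Walk
  wlen := E.wlen
  wdist := E.wdist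
  kterm c := E.kterm (𝔠.dec c)
  LocDep c := E.LocDep (𝔠.dec c)
  Converges c := E.Converges (𝔠.dec c)

/-- a configuration predicate of the record (Theorem 3.11's positivity slots, (3.185), (3.186)) READ ALONG THE DECODING.
[cite: Balaban1985BackgroundPropagators, Thm 3.11 p.416, (3.185)–(3.186) p.432, bookkeeping] -/
def pullC {X : Type} (P : B.Cfg → X) : 𝔠.bg.Cfg → X := fun c => P (𝔠.dec c)

/-- a predicate ON KERNEL FAMILIES of the record (Theorems 3.12 ∕ 3.13's «has the random-walk expansion», «is positive definite») READ ALONG THE DECODING: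
at a coded configuration `c` and a coded family `K′` it says «every record family pulling back to `K′` has the property at `dec c`» (`pullK` is injective,
`pullK_injective`, so at `K′ = pullK K` this IS the record's predicate at `K`). [cite: Balaban1985BackgroundPropagators, Thm 3.12 p.422, Thm 3.13 p.426, bookkeeping] -/
def pullPK {X : Type} (P : KernelFamily g B → B.Cfg → X → Prop) : KernelFamily g 𝔠.bg → 𝔠.bg.Cfg → X → Prop :=
  fun K' c x => ∀ K : KernelFamily g B, K' = pullK 𝔠 K → P K (𝔠.dec c) x

/-- the same for a two-argument family predicate (`PosDefK i K U`). [cite: Balaban1985BackgroundPropagators, Thm 3.12 p.422, bookkeeping] -/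
def pullPK₀ (P : KernelFamily g B → B.Cfg → Prop) : KernelFamily g 𝔠.bg → 𝔠.bg.Cfg → Prop :=
  fun K' c => ∀ K : KernelFamily g B, K' = pullK 𝔠 K → P K (𝔠.dec c)

/-- `pullH` is injective (the decoding is onto). [cite: Balaban1985BackgroundPropagators, (3.133) p.422, bookkeeping] -/
theorem pullH_injective : Function.Injective (pullH (g := g) 𝔠) := by
  intro H H' h
  have he : ∀ n U, H.e n U = H'.e n U := fun n U => by
    simpa [pullH] using congrArg (fun L : HKernel g 𝔠.bg => L.e n (.base U)) h
  have hh : ∀ U, H.h U = H'.h U := fun U => by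
    simpa [pullH] using congrArg (fun L : HKernel g 𝔠.bg => L.h (.base U)) h
  cases H; cases H'
  simp only [HKernel.mk.injEq]
  exact ⟨funext fun n => funext fun U => he n U, funext hh⟩

/-- a predicate ON `H`-KERNELS of the record READ ALONG THE DECODING. [cite: Balaban1985BackgroundPropagators, Thm 3.12 (3.133) p.422, bookkeeping] -/
def pullPH {X : Type} (P : HKernel g B → B.Cfg → X → Prop) : HKernel g 𝔠.bg → 𝔠.bg.Cfg → X → Prop :=
  fun H' c x => ∀ H : HKernel g B, H' = pullH 𝔠 H → P H (𝔠.dec c) x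

/-- the pulled-back family predicate at `pullK K` IS the record's at `(K, dec c)`. [cite: Balaban1985BackgroundPropagators, Thm 3.12 p.422, bookkeeping] -/
theorem pullPK_pullK_iff {X : Type} (P : KernelFamily g B → B.Cfg → X → Prop) (K : KernelFamily g B) (c : 𝔠.bg.Cfg) (x : X) :
    pullPK 𝔠 P (pullK 𝔠 K) c x ↔ P K (𝔠.dec c) x :=
  ⟨fun h => h K rfl, fun h K' hK' => by cases pullK_injective 𝔠 hK'; exact h⟩

/-- the same for the two-argument predicate. [cite: Balaban1985BackgroundPropagators, Thm 3.12 p.422, bookkeeping] -/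
theorem pullPK₀_pullK_iff (P : KernelFamily g B → B.Cfg → Prop) (K : KernelFamily g B) (c : 𝔠.bg.Cfg) :
    pullPK₀ 𝔠 P (pullK 𝔠 K) c ↔ P K (𝔠.dec c) :=
  ⟨fun h => h K rfl, fun h K' hK' => by cases pullK_injective 𝔠 hK'; exact h⟩

/-- the pulled-back `H`-predicate at `pullH H` IS the record's at `(H, dec c)`. [cite: Balaban1985BackgroundPropagators, Thm 3.12 (3.133) p.422, bookkeeping] -/
theorem pullPH_pullH_iff {X : Type} (P : HKernel g B → B.Cfg → X → Prop) (H : HKernel g B) (c : 𝔠.bg.Cfg) (x : X) :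
    pullPH 𝔠 P (pullH 𝔠 H) c x ↔ P H (𝔠.dec c) x :=
  ⟨fun h => h H rfl, fun h H' hH' => by cases pullH_injective 𝔠 hH'; exact h⟩

/-- the (3.42)∕(3.46)∕(3.47) block WITHOUT the Laplacian entries of the pulled-back family at `c` IS the record's at `dec c`.
[cite: Balaban1985BackgroundPropagators, Thm 3.12 p.422, bookkeeping] -/
theorem ineq342_346_347_noLap_pull_iff (K : KernelFamily g B) (B₀ δ₀ : ℝ) (c : 𝔠.bg.Cfg) :
    Ineq342_346_347_noLap (pullK 𝔠 K) B₀ δ₀ c ↔ Ineq342_346_347_noLap K B₀ δ₀ (𝔠.dec c) := Iff.rfl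

/-- (3.133) of the pulled-back `H`-kernel at `c` IS the record's at `dec c`. [cite: Balaban1985BackgroundPropagators, (3.133) p.422, bookkeeping] -/
theorem ineq3133_pull_iff (d : ℕ) (H : HKernel g B) (C : ℝ) (Cβ : ℝ → ℝ) (δ₁ : ℝ) (c : 𝔠.bg.Cfg) :
    Ineq3133 d (pullH 𝔠 H) C Cβ δ₁ c ↔ Ineq3133 d H C Cβ δ₁ (𝔠.dec c) := Iff.rfl

/-- (3.132) of the pulled-back kernel at `c` IS the record's at `dec c`. [cite: Balaban1985BackgroundPropagators, (3.132) p.422, bookkeeping] -/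
theorem ineq3132_pull_iff (d : ℕ) (K : SiteKernel g B) (C δ₁ : ℝ) (c : 𝔠.bg.Cfg) :
    Ineq3132 d (pullS 𝔠 K) C δ₁ c ↔ Ineq3132 d K C δ₁ (𝔠.dec c) := Iff.rfl

/-- (3.49) of the pulled-back fine kernel at `c` IS the record's at `dec c`. [cite: Balaban1985BackgroundPropagators, (3.49) p.399, bookkeeping] -/
theorem ineq349_pull_iff (d : ℕ) (P : FineKernel g B) (C δ₀ : ℝ) (c : 𝔠.bg.Cfg) :
    Ineq349 d (pullF 𝔠 P) C δ₀ c ↔ Ineq349 d P C δ₀ (𝔠.dec c) := Iff.rfl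

end Pull

/-! ## §2 The base-only printed statements of [B9] Sect. 3 TRANSFER FROM THE RECORD TO THE CODING ((3.35)-regular coded configurations are bases) -/

section Transfer

variable {I : Type} (d : ℕ) (c35 : ℝ) (geo : I → Geometry) (bg : I → Backgrounds) (𝔠 : ∀ i, Coding (bg i))

/-- ★ **THEOREM 3.1 TRANSFERS TO THE CODING.** [cite: Balaban1985BackgroundPropagators, Thm 3.1 (3.42)–(3.47) pp.397–398, (3.35) p.396] -/
theorem thm31Printed_coded (Gp : ∀ i, KernelFamily (geo i) (bg i)) (h : Thm31Printed c35 geo bg Gp) :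
    Thm31Printed c35 geo (fun i => (𝔠 i).bg) (fun i => pullK (𝔠 i) (Gp i)) := by
  obtain ⟨M₁, δ₀, a₀, B₀, Bβ, Bε, Bεβ, hM₁, hδ₀, ha₀, hB₀, H⟩ := h
  refine ⟨M₁, δ₀, a₀, B₀, Bβ, Bε, Bεβ, hM₁, hδ₀, ha₀, hB₀, fun i hM α₀ hα₀ hMα v hv => ?_⟩
  obtain ⟨U, rfl, hU⟩ := (𝔠 i).exists_of_bg_Reg335 hv
  exact H i hM α₀ hα₀ hMα U hU

/-- ★ **COROLLARY 3.6 TRANSFERS TO THE CODING.** [cite: Balaban1985BackgroundPropagators, Cor. 3.6 p.407, (3.35) p.396] -/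
theorem cor36Printed_coded (InCube : I → Prop) (Gp GA : ∀ i, KernelFamily (geo i) (bg i)) (Cinv : ∀ i, SiteKernel (geo i) (bg i))
    (h : Cor36Printed d c35 geo bg InCube Gp GA Cinv) :
    Cor36Printed d c35 geo (fun i => (𝔠 i).bg) InCube (fun i => pullK (𝔠 i) (Gp i)) (fun i => pullK (𝔠 i) (GA i)) (fun i => pullS (𝔠 i) (Cinv i)) := by
  obtain ⟨a₁, M₁, B₀, δ₀, Bβ, Bε, Bεβ, B₁, δ₁, ha₁, hM₁, hB₀, hδ₀, hB₁, hδ₁, H⟩ := h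
  refine ⟨a₁, M₁, B₀, δ₀, Bβ, Bε, Bεβ, B₁, δ₁, ha₁, hM₁, hB₀, hδ₀, hB₁, hδ₁, fun i hi hM α₀ hα₀ hMα v hv => ?_⟩
  obtain ⟨U, rfl, hU⟩ := (𝔠 i).exists_of_bg_Reg335 hv
  exact H i hi hM α₀ hα₀ hMα U hU

/-- ★ **THEOREM 3.7 TRANSFERS TO THE CODING** (expansion read along the decoding). [cite: Balaban1985BackgroundPropagators, Thm 3.7 (3.87) p.409, (3.35) p.396] -/
theorem thm37Printed_coded (E : ∀ i, RWExpansion (geo i) (bg i)) (h : Thm37Printed c35 geo bg E) :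
    Thm37Printed c35 geo (fun i => (𝔠 i).bg) (fun i => pullRW (𝔠 i) (E i)) := by
  obtain ⟨M₂, a₀, hM₂, ha₀, H⟩ := h
  refine ⟨M₂, a₀, hM₂, ha₀, fun i hM α₀ hα₀ hMα v hv => ?_⟩
  obtain ⟨U, rfl, hU⟩ := (𝔠 i).exists_of_bg_Reg335 hv
  exact H i hM α₀ hα₀ hMα U hU

/-- ★ **COROLLARY 3.8 TRANSFERS TO THE CODING.** [cite: Balaban1985BackgroundPropagators, Cor. 3.8 (3.94) p.410, (3.35) p.396] -/
theorem cor38Printed_coded (E : ∀ i, RWExpansion (geo i) (bg i)) (h : Cor38Printed c35 geo bg E) :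
    Cor38Printed c35 geo (fun i => (𝔠 i).bg) (fun i => pullRW (𝔠 i) (E i)) := by
  obtain ⟨M₂, a₀, δ₀, C, c, hM₂, ha₀, hδ₀, hC, hc, H⟩ := h
  refine ⟨M₂, a₀, δ₀, C, c, hM₂, ha₀, hδ₀, hC, hc, fun i hM α₀ hα₀ hMα v hv => ?_⟩
  obtain ⟨U, rfl, hU⟩ := (𝔠 i).exists_of_bg_Reg335 hv
  exact H i hM α₀ hα₀ hMα U hU

/-- ★ **THEOREM 3.9 TRANSFERS TO THE CODING.** [cite: Balaban1985BackgroundPropagators, Thm 3.9 (3.99) p.412, (3.35) p.396] -/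
theorem thm39Printed_coded (E : ∀ i, RWKernelExpansion (geo i) (bg i)) (h : Thm39Printed d c35 geo bg E) :
    Thm39Printed d c35 geo (fun i => (𝔠 i).bg) (fun i => pullRWK (𝔠 i) (E i)) := by
  obtain ⟨M₂, a₀, δ₀, C, c, hM₂, ha₀, hδ₀, hC, hc, H⟩ := h
  refine ⟨M₂, a₀, δ₀, C, c, hM₂, ha₀, hδ₀, hC, hc, fun i hM α₀ hα₀ hMα v hv => ?_⟩
  obtain ⟨U, rfl, hU⟩ := (𝔠 i).exists_of_bg_Reg335 hv
  exact H i hM α₀ hα₀ hMα U hU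

/-- ★ **THEOREM 3.10 TRANSFERS TO THE CODING.** [cite: Balaban1985BackgroundPropagators, Thm 3.10 (3.107) p.415, (3.35) p.396] -/
theorem thm310Printed_coded (E : ∀ i, RWExpansion (geo i) (bg i)) (h : Thm310Printed c35 geo bg E) :
    Thm310Printed c35 geo (fun i => (𝔠 i).bg) (fun i => pullRW (𝔠 i) (E i)) := by
  obtain ⟨M₂, a₀, δ₀, C, c, hM₂, ha₀, hδ₀, hC, hc, H⟩ := h
  refine ⟨M₂, a₀, δ₀, C, c, hM₂, ha₀, hδ₀, hC, hc, fun i hM α₀ hα₀ hMα v hv => ?_⟩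
  obtain ⟨U, rfl, hU⟩ := (𝔠 i).exists_of_bg_Reg335 hv
  exact H i hM α₀ hα₀ hMα U hU

/-- ★ **THEOREM 3.11 TRANSFERS TO THE CODING.** [cite: Balaban1985BackgroundPropagators, Thm 3.11 p.416, (3.35) p.396] -/
theorem thm311Printed_coded (PosDef : ∀ i, Fin 5 → (bg i).Cfg → Prop) (h : Thm311Printed c35 geo bg PosDef) :
    Thm311Printed c35 geo (fun i => (𝔠 i).bg) (fun i n => pullC (𝔠 i) (PosDef i n)) := by
  obtain ⟨M₃, a₀, hM₃, ha₀, H⟩ := h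
  refine ⟨M₃, a₀, hM₃, ha₀, fun i hM α₀ hα₀ hMα v hv => ?_⟩
  obtain ⟨U, rfl, hU⟩ := (𝔠 i).exists_of_bg_Reg335 hv
  exact H i hM α₀ hα₀ hMα U hU

/-- ★ **THEOREM 3.12 TRANSFERS TO THE CODING** (the four operators and their predicates read along the decoding).
[cite: Balaban1985BackgroundPropagators, Thm 3.12 (3.130)–(3.133) pp.421–422, (3.35)–(3.36) p.396] -/
theorem thm312Printed_coded (GD G₁ : ∀ i, KernelFamily (geo i) (bg i)) (H H₁ : ∀ i, HKernel (geo i) (bg i))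
    (HasRWExp : ∀ i, KernelFamily (geo i) (bg i) → (bg i).Cfg → ℝ → Prop) (HasRWExpH : ∀ i, HKernel (geo i) (bg i) → (bg i).Cfg → ℝ → Prop)
    (PosDefK : ∀ i, KernelFamily (geo i) (bg i) → (bg i).Cfg → Prop) (h : Thm312Printed d c35 geo bg GD G₁ H H₁ HasRWExp HasRWExpH PosDefK) :
    Thm312Printed d c35 geo (fun i => (𝔠 i).bg) (fun i => pullK (𝔠 i) (GD i)) (fun i => pullK (𝔠 i) (G₁ i)) (fun i => pullH (𝔠 i) (H i))
      (fun i => pullH (𝔠 i) (H₁ i)) (fun i => pullPK (𝔠 i) (HasRWExp i)) (fun i => pullPH (𝔠 i) (HasRWExpH i)) (fun i => pullPK₀ (𝔠 i) (PosDefK i)) := by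
  obtain ⟨M₄, δ₀, a₀, B₀, Bβ, Bε, Bεβ, hM₄, hδ₀, ha₀, hB₀, Hm⟩ := h
  refine ⟨M₄, δ₀, a₀, B₀, Bβ, Bε, Bεβ, hM₄, hδ₀, ha₀, hB₀, fun i hM α₀ hα₀ hMα v hv hv' => ?_⟩
  obtain ⟨U, rfl, hU⟩ := (𝔠 i).exists_of_bg_Reg335 hv
  obtain ⟨hK, hH⟩ := Hm i hM α₀ hα₀ hMα U hU hv'
  refine ⟨fun K hK' => ?_, fun Hk hHk => ?_⟩
  · simp only [List.mem_cons, List.not_mem_nil, or_false] at hK'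
    rcases hK' with rfl | rfl
    · obtain ⟨h1, h2, h3, h4⟩ := hK (GD i) (by simp)
      exact ⟨h1, h2, (pullPK_pullK_iff (𝔠 i) (HasRWExp i) (GD i) _ δ₀).2 h3, (pullPK₀_pullK_iff (𝔠 i) (PosDefK i) (GD i) _).2 h4⟩
    · obtain ⟨h1, h2, h3, h4⟩ := hK (G₁ i) (by simp)
      exact ⟨h1, h2, (pullPK_pullK_iff (𝔠 i) (HasRWExp i) (G₁ i) _ δ₀).2 h3, (pullPK₀_pullK_iff (𝔠 i) (PosDefK i) (G₁ i) _).2 h4⟩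
  · simp only [List.mem_cons, List.not_mem_nil, or_false] at hHk
    rcases hHk with rfl | rfl
    · obtain ⟨h1, h2⟩ := hH (H i) (by simp)
      exact ⟨h1, (pullPH_pullH_iff (𝔠 i) (HasRWExpH i) (H i) _ δ₀).2 h2⟩
    · obtain ⟨h1, h2⟩ := hH (H₁ i) (by simp)
      exact ⟨h1, (pullPH_pullH_iff (𝔠 i) (HasRWExpH i) (H₁ i) _ δ₀).2 h2⟩

/-- ★ **THEOREM 3.13 TRANSFERS TO THE CODING.** [cite: Balaban1985BackgroundPropagators, Thm 3.13 (3.154) p.426, (3.35)–(3.36) p.396] -/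
theorem thm313Printed_coded (GG : ∀ i, KernelFamily (geo i) (bg i)) (HasRWExp : ∀ i, KernelFamily (geo i) (bg i) → (bg i).Cfg → ℝ → Prop)
    (PosDefK : ∀ i, KernelFamily (geo i) (bg i) → (bg i).Cfg → Prop) (h : Thm313Printed c35 geo bg GG HasRWExp PosDefK) :
    Thm313Printed c35 geo (fun i => (𝔠 i).bg) (fun i => pullK (𝔠 i) (GG i)) (fun i => pullPK (𝔠 i) (HasRWExp i)) (fun i => pullPK₀ (𝔠 i) (PosDefK i)) := by
  obtain ⟨M₄, δ₀, a₀, B₀, Bβ, Bε, Bεβ, hM₄, hδ₀, ha₀, hB₀, Hm⟩ := h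
  refine ⟨M₄, δ₀, a₀, B₀, Bβ, Bε, Bεβ, hM₄, hδ₀, ha₀, hB₀, fun i hM α₀ hα₀ hMα v hv hv' => ?_⟩
  obtain ⟨U, rfl, hU⟩ := (𝔠 i).exists_of_bg_Reg335 hv
  obtain ⟨h1, h2, h3, h4⟩ := Hm i hM α₀ hα₀ hMα U hU hv'
  exact ⟨h1, h2, (pullPK_pullK_iff (𝔠 i) (HasRWExp i) (GG i) _ δ₀).2 h3, (pullPK₀_pullK_iff (𝔠 i) (PosDefK i) (GG i) _).2 h4⟩

/-- ★ **THEOREM 3.14 (sup entries) TRANSFERS TO THE CODING.** [cite: Balaban1985BackgroundPropagators, Thm 3.14 pp.426–427, (3.35) p.396] -/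
theorem thm314Printed_coded (Kdiff : ∀ i, KernelFamily (geo i) (bg i)) (dOmega : ∀ i, (geo i).Site → (geo i).Site → ℝ)
    (h : Thm314Printed c35 geo bg Kdiff dOmega) : Thm314Printed c35 geo (fun i => (𝔠 i).bg) (fun i => pullK (𝔠 i) (Kdiff i)) dOmega := by
  obtain ⟨M₅, δ₀, a₀, B₀, hM₅, hδ₀, ha₀, hB₀, H⟩ := h
  refine ⟨M₅, δ₀, a₀, B₀, hM₅, hδ₀, ha₀, hB₀, fun i hM α₀ hα₀ hMα v hv => ?_⟩
  obtain ⟨U, rfl, hU⟩ := (𝔠 i).exists_of_bg_Reg335 hv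
  exact H i hM α₀ hα₀ hMα U hU

/-- ★ **THEOREM 3.14 (local reading) TRANSFERS TO THE CODING.** [cite: Balaban1985BackgroundPropagators, Thm 3.14 pp.426–427, (3.35) p.396] -/
theorem thm314LocalPrinted_coded (Kdiff : ∀ i, KernelFamily (geo i) (bg i)) (OmK : ∀ i, (geo i).Site → Prop)
    (dOmega : ∀ i, (geo i).Site → (geo i).Site → ℝ) (h : Thm314LocalPrinted c35 geo bg Kdiff OmK dOmega) :
    Thm314LocalPrinted c35 geo (fun i => (𝔠 i).bg) (fun i => pullK (𝔠 i) (Kdiff i)) OmK dOmega := by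
  obtain ⟨M₅, δ₀, a₀, B₀, Bβ, Bε, Bεβ, hM₅, hδ₀, ha₀, hB₀, H⟩ := h
  refine ⟨M₅, δ₀, a₀, B₀, Bβ, Bε, Bεβ, hM₅, hδ₀, ha₀, hB₀, fun i hM α₀ hα₀ hMα v hv => ?_⟩
  obtain ⟨U, rfl, hU⟩ := (𝔠 i).exists_of_bg_Reg335 hv
  exact H i hM α₀ hα₀ hMα U hU

/-- ★ **THEOREM 3.15 (full) TRANSFERS TO THE CODING.** [cite: Balaban1985BackgroundPropagators, Thm 3.15 (3.185)–(3.187) p.432, (3.35)–(3.36) p.396] -/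
theorem thm315FullPrinted_coded (Ck : ∀ i, SiteKernel (geo i) (bg i)) (inΛ : ∀ i, (geo i).Site → Prop)
    (unitDist : ∀ i, (geo i).Site → (geo i).Site → ℝ) (GivenBy3185 : ∀ i, (bg i).Cfg → Prop) (HasRWExpC : ∀ i, (bg i).Cfg → ℝ → Prop)
    (h : Thm315FullPrinted c35 geo bg Ck inΛ unitDist GivenBy3185 HasRWExpC) :
    Thm315FullPrinted c35 geo (fun i => (𝔠 i).bg) (fun i => pullS (𝔠 i) (Ck i)) inΛ unitDist (fun i => pullC (𝔠 i) (GivenBy3185 i))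
      (fun i => pullC (𝔠 i) (HasRWExpC i)) := by
  obtain ⟨δ₀, a₀, B₀, hδ₀, ha₀, hB₀, H⟩ := h
  refine ⟨δ₀, a₀, B₀, hδ₀, ha₀, hB₀, fun i α₀ hα₀ hMα v hv hv' => ?_⟩
  obtain ⟨U, rfl, hU⟩ := (𝔠 i).exists_of_bg_Reg335 hv
  exact H i α₀ hα₀ hMα U hU hv'

/-- ★ **(3.49) TRANSFERS TO THE CODING.** [cite: Balaban1985BackgroundPropagators, (3.49) p.399, (3.35) p.396] -/
theorem stmt349Printed_coded (P : ∀ i, FineKernel (geo i) (bg i)) (h : Stmt349Printed d c35 geo bg P) :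
    Stmt349Printed d c35 geo (fun i => (𝔠 i).bg) (fun i => pullF (𝔠 i) (P i)) := by
  obtain ⟨M₁, δ₀, a₀, C, hM₁, hδ₀, ha₀, hC, H⟩ := h
  refine ⟨M₁, δ₀, a₀, C, hM₁, hδ₀, ha₀, hC, fun i hM α₀ hα₀ hMα v hv => ?_⟩
  obtain ⟨U, rfl, hU⟩ := (𝔠 i).exists_of_bg_Reg335 hv
  exact H i hM α₀ hα₀ hMα U hU

/-- ★ **(3.132) TRANSFERS TO THE CODING.** [cite: Balaban1985BackgroundPropagators, (3.132) p.422, (3.35)–(3.36) p.396] -/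
theorem stmt3132Printed_coded (Q Q₁ : ∀ i, SiteKernel (geo i) (bg i)) (h : Stmt3132Printed d c35 geo bg Q Q₁) :
    Stmt3132Printed d c35 geo (fun i => (𝔠 i).bg) (fun i => pullS (𝔠 i) (Q i)) (fun i => pullS (𝔠 i) (Q₁ i)) := by
  obtain ⟨M₄, δ₁, a₀, C, hM₄, hδ₁, ha₀, hC, H⟩ := h
  refine ⟨M₄, δ₁, a₀, C, hM₄, hδ₁, ha₀, hC, fun i hM α₀ hα₀ hMα v hv hv' => ?_⟩
  obtain ⟨U, rfl, hU⟩ := (𝔠 i).exists_of_bg_Reg335 hv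
  exact H i hM α₀ hα₀ hMα U hU hv'

end Transfer

end Literature.MathematicalPhysics.QuantumFieldTheory.Balaban1983to89.B9SectBCodedCarrierPullbacks
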